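import Summits.Parity.BatemanHorn.Theorems.SoloInformedLocatedMangoldt
import Summits.Parity.BatemanHorn.Theorems.SoloInformedMidWindowCancellation

/-!
# SoloInformedMidWindowMangoldt — the mid-window cancellation is genuine: its prime layer is `-(ε₂-ε₁) x log x`

Solo unit `solo-Parity-informed` (ideation tier, informed mode), session 20; `PLAN.md` §28, CLAIMS C97.

Companion of `SoloInformedMidWindowCancellation` for one polynomial (`k = 1`).  For `g ∈ ℤ[X]` irreducible of
degree `d ≥ 1` without natural roots and `0 < ε₁ ≤ ε₂ < 1`:

* (`midWindow_vonMangoldt_isLittleO`) `∑_{n ≤ x} ∑_{e ∣ g(n), x^{1-ε₂} < e ≤ x^{1-ε₁}} Λ(e) = (ε₂ - ε₁) x log x + o(x)`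
  — the difference of two instances of Theorem A of `SoloInformedLocatedMangoldt` (the secondary constants cancel);
* (`midWindow_compositeLayers_isLittleO`, `g` a Bateman–Horn polynomial) with the prime-vanishing weight
  `ν = μ·log + Λ`: `∑_{n ≤ x} ∑_{m ∣ g(n), x^{1-ε₂} < m ≤ x^{1-ε₁}} ν(m) = (ε₂ - ε₁) x log x + o(x)`;
* (`sqAddOne_midWindow_moebiusLog_isLittleO`) for `n² + 1`: `∑_{n ≤ x} ∑_{e ∣ n²+1, x^{1-ε₂} < e ≤ x^{1-ε₁}} μ(e) log e = o(x)`,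
  while the primes of that window alone contribute `-(ε₂ - ε₁) x log x + o(x)`.

So in every window strictly below the exponent `1` the Möbius sign cancels a mass of exact order `x log x`
(for `k = 1`; the prime layer `-(ε₂-ε₁) x log x` is compensated by the composite layers to `o(x)`) — an
unconditional theorem — whereas the same cancellation in the window `e > x^{1-ε}` is the Bateman–Horn
conjecture for `g` (`SoloInformedBatemanHornLocalisation`; for the secondary-term form see
`SoloInformedPrimeLayerBias`).  No new arithmetic input.
-/

namespace Summit.Parity.BatemanHorn.Theorems

namespace LocatedMangoldt

open Finset Filter ArithmeticFunction Asymptotics Polynomial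
open scoped Topology ArithmeticFunction.Moebius
open Literature.NumberTheory.Sieve (polyRootCountMod IsBatemanHornSystem)

/-- **The located von Mangoldt mass of a window below the exponent `1`.**  For `g` irreducible of degree
`d ≥ 1` without natural roots and `0 < ε₁ ≤ ε₂ < 1`:
`∑_{n ≤ x} ∑_{e ∣ g(n), x^{1-ε₂} < e ≤ x^{1-ε₁}} Λ(e) = (ε₂ - ε₁) x log x + o(x)`. -/
theorem midWindow_vonMangoldt_isLittleO {g : ℤ[X]} (hirr : Irreducible g) (hdeg : 0 < g.natDegree)
    (hg0 : ∀ n : ℕ, 1 ≤ n → g.eval (n : ℤ) ≠ 0) {ε₁ ε₂ : ℝ} (hε1 : 0 < ε₁) (h12 : ε₁ ≤ ε₂)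
    (hε2 : ε₂ < 1) :
    (fun x : ℕ => ∑ n ∈ Icc 1 x, ∑ e ∈ ((g.eval (n : ℤ)).natAbs.divisors).filter
          (fun e => ⌊(x : ℝ) ^ (1 - ε₂)⌋₊ < e ∧ e ≤ ⌊(x : ℝ) ^ (1 - ε₁)⌋₊), Λ e
        - (ε₂ - ε₁) * x * Real.log x) =o[atTop] fun x : ℕ => (x : ℝ) := by
  obtain ⟨γ₁, hγ₁, h1⟩ := locatedVonMangoldt_isLittleO hirr hdeg hg0 hε1 (lt_of_le_of_lt h12 hε2)
  obtain ⟨γ₂, hγ₂, h2⟩ := locatedVonMangoldt_isLittleO hirr hdeg hg0 (lt_of_lt_of_le hε1 h12) hε2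
  have hγ : γ₂ = γ₁ := neg_injective (tendsto_nhds_unique hγ₂ hγ₁)
  subst hγ
  have hwin : ∀ x : ℕ, ∑ n ∈ Icc 1 x, ∑ e ∈ ((g.eval (n : ℤ)).natAbs.divisors).filter
        (fun e => ⌊(x : ℝ) ^ (1 - ε₂)⌋₊ < e), Λ e
      - ∑ n ∈ Icc 1 x, ∑ e ∈ ((g.eval (n : ℤ)).natAbs.divisors).filter
        (fun e => ⌊(x : ℝ) ^ (1 - ε₁)⌋₊ < e), Λ e
      = ∑ n ∈ Icc 1 x, ∑ e ∈ ((g.eval (n : ℤ)).natAbs.divisors).filter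
          (fun e => ⌊(x : ℝ) ^ (1 - ε₂)⌋₊ < e ∧ e ≤ ⌊(x : ℝ) ^ (1 - ε₁)⌋₊), Λ e := by
    intro x
    rw [← sum_sub_distrib]
    refine sum_congr rfl fun n _ => ?_
    rw [sum_filter, sum_filter, sum_filter, ← sum_sub_distrib]
    refine sum_congr rfl fun e _ => ?_
    have hx := rpowCut_mono h12 hε2 x
    split_ifs <;> first | (exfalso; omega) | simp
  refine (h2.sub h1).congr_left fun x => ?_
  rw [← hwin x]
  ring

/-- **The prime-vanishing layers of a window carry its whole `Λ`-mass.**  For a Bateman–Horn polynomial `g`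
(`IsBatemanHornSystem ![g]`) and `0 < ε₁ ≤ ε₂ < 1`, with `ν = μ·log + Λ` (zero at primes):
`∑_{n ≤ x} ∑_{m ∣ g(n), x^{1-ε₂} < m ≤ x^{1-ε₁}} ν(m) = (ε₂ - ε₁) x log x + o(x)` — unconditionally; i.e. the
composite layers of the window compensate the prime layer `-(ε₂ - ε₁) x log x` of the Möbius sum exactly. -/
theorem midWindow_compositeLayers_isLittleO {g : ℤ[X]} (hg : IsBatemanHornSystem ![g])
    (hg0 : ∀ n : ℕ, 1 ≤ n → g.eval (n : ℤ) ≠ 0) {ε₁ ε₂ : ℝ} (hε1 : 0 < ε₁) (h12 : ε₁ ≤ ε₂)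
    (hε2 : ε₂ < 1) :
    (fun x : ℕ => ∑ n ∈ Icc 1 x, ∑ m ∈ ((g.eval (n : ℤ)).natAbs.divisors).filter
          (fun m => ⌊(x : ℝ) ^ (1 - ε₂)⌋₊ < m ∧ m ≤ ⌊(x : ℝ) ^ (1 - ε₁)⌋₊), ((μ m : ℝ) * Real.log m + Λ m)
        - (ε₂ - ε₁) * x * Real.log x) =o[atTop] fun x : ℕ => (x : ℝ) := by
  have hirr : Irreducible g := by simpa using hg.irreducible 0
  have hdeg : 0 < g.natDegree := by simpa using hg.natDegree_pos 0
  have hΛ := midWindow_vonMangoldt_isLittleO hirr hdeg hg0 hε1 h12 hε2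
  have hμ := midWindow_twoRpowCuts_isLittleO hg (by simp) hε1 h12 hε2
  have hF : (∏ i, (![g]) i) = g := by simp
  simp only [hF, Fintype.card_fin, pow_one] at hμ
  refine (hμ.add hΛ).congr_left fun x => ?_
  rw [← add_sub_assoc, ← sum_add_distrib]
  congr 1
  refine sum_congr rfl fun n _ => ?_
  rw [← sum_add_distrib]

/-- **The instance `n² + 1`.**  For `0 < ε₁ ≤ ε₂ < 1`:
`∑_{n ≤ x} ∑_{e ∣ n²+1, x^{1-ε₂} < e ≤ x^{1-ε₁}} μ(e) log e = o(x)` (unconditional Möbius cancellation), while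
`∑_{n ≤ x} ∑_{e ∣ n²+1, x^{1-ε₂} < e ≤ x^{1-ε₁}} Λ(e) = (ε₂ - ε₁) x log x + o(x)` (the mass that cancels). -/
theorem sqAddOne_midWindow_moebiusLog_isLittleO {ε₁ ε₂ : ℝ} (hε1 : 0 < ε₁) (h12 : ε₁ ≤ ε₂)
    (hε2 : ε₂ < 1) :
    ((fun x : ℕ => ∑ n ∈ Icc 1 x, ∑ e ∈ (n ^ 2 + 1).divisors with
          (⌊(x : ℝ) ^ (1 - ε₂)⌋₊ < e ∧ e ≤ ⌊(x : ℝ) ^ (1 - ε₁)⌋₊), (μ e : ℝ) * Real.log e)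
        =o[atTop] fun x : ℕ => (x : ℝ)) ∧
    ((fun x : ℕ => ∑ n ∈ Icc 1 x, ∑ e ∈ (n ^ 2 + 1).divisors with
          (⌊(x : ℝ) ^ (1 - ε₂)⌋₊ < e ∧ e ≤ ⌊(x : ℝ) ^ (1 - ε₁)⌋₊), Λ e
        - (ε₂ - ε₁) * x * Real.log x) =o[atTop] fun x : ℕ => (x : ℝ)) := by
  have hg := Literature.NumberTheory.Sieve.isBatemanHornSystem_X_sq_add_one
  have hirr : Irreducible (X ^ 2 + 1 : ℤ[X]) := by simpa using hg.irreducible 0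
  have hdeg : 0 < (X ^ 2 + 1 : ℤ[X]).natDegree := by simpa using hg.natDegree_pos 0
  have hN : ∀ n : ℕ, ((X ^ 2 + 1 : ℤ[X]).eval (n : ℤ)).natAbs = n ^ 2 + 1 := by
    intro n
    simp only [eval_add, eval_pow, eval_X, eval_one]
    norm_cast
  have hg0 : ∀ n : ℕ, 1 ≤ n → (X ^ 2 + 1 : ℤ[X]).eval (n : ℤ) ≠ 0 := by
    intro n _ h
    have := hN n
    rw [h] at this
    simp at this
  have hF : (∏ i, (![(X ^ 2 + 1 : ℤ[X])]) i) = X ^ 2 + 1 := by simp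
  constructor
  · have hμ := midWindow_twoRpowCuts_isLittleO hg (by simp) hε1 h12 hε2
    simp only [hF, Fintype.card_fin, pow_one, hN] at hμ
    exact hμ
  · have hΛ := midWindow_vonMangoldt_isLittleO hirr hdeg hg0 hε1 h12 hε2
    simp only [hN] at hΛ
    exact hΛ

end LocatedMangoldt

end Summit.Parity.BatemanHorn.Theorems
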